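import Summits.CriticalPhenomena.Ising3DConformalLimit.Theses.FKParityRobustness
import Summits.CriticalPhenomena.Ising3DConformalLimit.Theorems.FKParityRobustnessDefs
import Literature.Combinatorics.SimpleGraph.CycleSpaceSeparators
import HarnessLib

/-!
# `ParityRobustMerging` (item stmt-CriticalPhenomena-11253): load-bearing hypotheses

Negative knowledge about the crux
`Summit.CriticalPhenomena.Ising3DConformalLimit.Theses.FKParityRobustness.ParityRobustMerging`
(standing crux disprover, cycle 1, D-0016) and about the transfer stub of its picked line
`plaquette-xor-surgery`:

* `parityRobustMerging_false_without_hl` — the crux's only hypothesis `1 ≤ l` cannot be dropped: at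
  `l = 0` the four sources coincide, no `T`-join with a singleton odd set exists (handshake lemma,
  `sol_eq_empty_of_const`), so `u ≡ 0` while `φ[all joined] = 1`.  The hypothesis enters only through
  the injectivity of the source map.
* `fkTransfer_false_without_injective` — the line's stub `stub_fkLoopTransfer` with
  `Function.Injective a` dropped is false (constant sources on the one-point graph: both loop masses
  vanish, `zMass_eq_zero_of_const`, while the FK side reads `1 ≤ 0`).

Theorem-only file (no new definitions); the negated statements are the crux / the stub verbatim with
the one hypothesis deleted.
-/

noncomputable section

namespace Summit.CriticalPhenomena.Ising3DConformalLimit.ParityRobustMergingNegative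

open MeasureTheory Finset
open Literature.Probability.LatticeModels
open Literature.Combinatorics.SimpleGraph.CycleSpace
open Summit.CriticalPhenomena.Ising3DConformalLimit.Cruxes.ParityRobustMerging.PlaquetteXorSurgery
open scoped Classical

section General

variable {V : Type*} [Fintype V] [DecidableEq V] (G : SimpleGraph V) [DecidableRel G.Adj]

/-- If the four sources coincide, the crux's `sol ω` (`T`-joins of `A = image a` inside `ω`) is EMPTY
for every `ω`: a `T`-join would have exactly one odd-degree vertex, contradicting the handshake lemma
in its component (`exists_reachable_odd_of_odd`). [folklore] -/
theorem sol_eq_empty_of_const (a : Fin 4 → V) (ha : ∀ i, a i = a 0) (ω : Set (Sym2 V)) :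
    G.edgeFinset.powerset.filter (fun F : Finset (Sym2 V) => (↑F : Set (Sym2 V)) ⊆ ω ∧
      ∀ v, Odd (F.filter (fun e => v ∈ e)).card ↔ v ∈ Finset.univ.image a) = ∅ := by
  refine Finset.filter_eq_empty_iff.2 ?_
  rintro F hF ⟨-, hpar⟩
  have hFE : ∀ e ∈ F, ¬ e.IsDiag := fun e he =>
    SimpleGraph.not_isDiag_of_mem_edgeSet G (SimpleGraph.mem_edgeFinset.1 (Finset.mem_powerset.1 hF he))
  have h0 : Odd (edgeDeg F (a 0)) := (hpar (a 0)).2 (Finset.mem_image_of_mem a (Finset.mem_univ 0))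
  obtain ⟨w, hw, -, hwodd⟩ := exists_reachable_odd_of_odd F hFE h0
  obtain ⟨i, -, hi⟩ := Finset.mem_image.1 ((hpar w).1 hwodd)
  exact hw (hi.symm.trans (ha i))

/-- Same fact for the line's vocabulary: `tJoins G ω (image a) = ∅` when `a` is constant. [folklore] -/
theorem tJoins_image_eq_empty_of_const (a : Fin 4 → V) (ha : ∀ i, a i = a 0) (ω : Set (Sym2 V)) :
    tJoins G ω (Finset.univ.image a) = ∅ := by
  refine Finset.eq_empty_iff_forall_notMem.2 fun F hF => ?_
  obtain ⟨hFG, -, hpar⟩ := (mem_tJoins G).1 hF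
  have hFE : ∀ e ∈ F, ¬ e.IsDiag := fun e he =>
    SimpleGraph.not_isDiag_of_mem_edgeSet G (SimpleGraph.mem_edgeFinset.1 (hFG he))
  have h0 : Odd (edgeDeg F (a 0)) := (hpar (a 0)).2 (Finset.mem_image_of_mem a (Finset.mem_univ 0))
  obtain ⟨w, hw, -, hwodd⟩ := exists_reachable_odd_of_odd F hFE h0
  obtain ⟨i, -, hi⟩ := Finset.mem_image.1 ((hpar w).1 hwodd)
  exact hw (hi.symm.trans (ha i))

/-- Hence every loop-O(1) mass of the line vanishes for constant sources. [folklore] -/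
theorem zMass_eq_zero_of_const (t : ℝ) (a : Fin 4 → V) (ha : ∀ i, a i = a 0)
    (P : Finset (Sym2 V) → Prop) : zMass G t a P = 0 := by
  simp [zMass, tJoins_image_eq_empty_of_const G a ha]

end General

/-! ## The two load-bearing hypotheses -/

/-- **`1 ≤ l` is load-bearing.**  Without it, take `l = 0`: the four sources all sit at the origin, the
all-joined event is sure (`φ` is a probability measure) while `sol ω = ∅` for every `ω`
(`sol_eq_empty_of_const`), so `u ≡ 0/0 = 0` and the inequality reads `c · 1 ≤ 0`, absurd for `c > 0`.
Moral for provers: the hypothesis enters ONLY through the injectivity of `a` (four distinct sources);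
nothing else distinguishes `l ≥ 1` from `l = 0`. [folklore] -/
theorem parityRobustMerging_false_without_hl :
    ¬ (let tetra : Fin 4 → Literature.Probability.LatticeModels.Site 3 := ![![-1, -1, -1], ![1, 1, -1], ![1, -1, 1], ![-1, 1, 1]]; ∃ c : ℝ, 0 < c ∧ ∀ l : ℕ, ∃ N₀ : ℕ, ∀ N : ℕ, N₀ ≤ N → ∀ a : Fin 4 → ↥(Literature.Probability.LatticeModels.box 3 N), (∀ i, ((a i : Literature.Probability.LatticeModels.Site 3)) = (l : ℤ) • tetra i) → (let G := ((Literature.Probability.LatticeModels.zdGraph 3).comap (Subtype.val : ↥(Literature.Probability.LatticeModels.box 3 N) → Literature.Probability.LatticeModels.Site 3)); let φ := Literature.Probability.LatticeModels.rcMeasure G (Literature.Probability.LatticeModels.fkIsingParam (Literature.Probability.LatticeModels.criticalBeta 3)) 2 ∅; let sol : Set (Sym2 ↥(Literature.Probability.LatticeModels.box 3 N)) → Finset (Finset (Sym2 ↥(Literature.Probability.LatticeModels.box 3 N))) := fun ω => G.edgeFinset.powerset.filter (fun F => (↑F : Set (Sym2 ↥(Literature.Probability.LatticeModels.box 3 N)))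 ⊆ ω ∧ ∀ v, Odd (F.filter (fun e => v ∈ e)).card ↔ v ∈ Finset.univ.image a); let u : Set (Sym2 ↥(Literature.Probability.LatticeModels.box 3 N)) → ℝ := fun ω => (((sol ω).filter (fun F => ∀ i j, (SimpleGraph.fromEdgeSet (↑F : Set (Sym2 ↥(Literature.Probability.LatticeModels.box 3 N)))).Reachable (a i) (a j))).card : ℝ) / ((sol ω).card : ℝ); c * φ.real {ω | ∀ i j, (Literature.Probability.Percolation.openGraph ω).Reachable (a i) (a j)} ≤ ∫ ω, u ω ∂φ)) := by
  rintro ⟨c, hc, h⟩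
  obtain ⟨N₀, hN⟩ := h 0
  set a : Fin 4 → ↥(box 3 N₀) := fun _ => ⟨0, zero_mem_box 3 N₀⟩ with ha_def
  have ha : ∀ i, ((a i : Site 3)) = ((0 : ℕ) : ℤ) •
      (![![-1, -1, -1], ![1, 1, -1], ![1, -1, 1], ![-1, 1, 1]] : Fin 4 → Site 3) i := by
    intro i; simp [ha_def]
  have key := hN N₀ le_rfl a ha
  have ha0 : ∀ i, a i = a 0 := fun _ => rfl
  have hsol := sol_eq_empty_of_const ((zdGraph 3).comap (Subtype.val : ↥(box 3 N₀) → Site 3)) a ha0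
  have hset : {ω : Set (Sym2 ↥(box 3 N₀)) |
      ∀ i j : Fin 4, (Literature.Probability.Percolation.openGraph ω).Reachable (a i) (a j)} = Set.univ :=
    Set.eq_univ_of_forall fun ω i j => SimpleGraph.Reachable.refl _
  haveI : IsProbabilityMeasure (rcMeasure ((zdGraph 3).comap (Subtype.val : ↥(box 3 N₀) → Site 3))
      (fkIsingParam (criticalBeta 3)) 2 ∅) :=
    isProbabilityMeasure_rcMeasure _ (fkIsingParam_mem_Icc (criticalBeta_nonneg 3)) (by norm_num) _
  simp only [hsol, hset, probReal_univ, Finset.card_empty, Nat.cast_zero, div_zero,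
    integral_zero, mul_one] at key
  exact absurd key (not_le.2 hc)

/-- **`Function.Injective a` is load-bearing in `stub_fkLoopTransfer`.**  The line's transfer stub
(`FKTransfer` of `Lines/plaquette-xor-surgery.lean`) with the injectivity hypothesis dropped is FALSE:
on the one-point graph with the constant source map and `c = 1`, `β = 0`, both loop masses vanish
(`zMass_eq_zero_of_const`: no `T`-join has odd set a singleton), so the hypothesis `c·Z(A) ≤ Z(A;C)`
holds, while the conclusion reads `1 · φ[all joined] = 1 ≤ ∫ u dφ = 0`.  So the stub's proof must use
injectivity — it does so exactly once, in `{all aᵢ joined} ⊆ 𝓕_A` (two pairing PATHS with distinct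
ends are needed to build a `T`-join).  Statement = the stub verbatim minus `Function.Injective a →`.
[folklore] -/
theorem fkTransfer_false_without_injective :
    ¬ ∀ (V : Type) [Fintype V] [DecidableEq V] (G : SimpleGraph V) [DecidableRel G.Adj] (β : ℝ),
      0 ≤ β → ∀ a : Fin 4 → V, ∀ c : ℝ,
        c * zMass G (Real.tanh β) a (fun _ => True) ≤ zMass G (Real.tanh β) a (fun F => JoinsAll a F) →
  (let φ := Literature.Probability.LatticeModels.rcMeasure G (Literature.Probability.LatticeModels.fkIsingParam β) 2 ∅; let sol : Set (Sym2 V) → Finset (Finset (Sym2 V)) := fun ω => G.edgeFinset.powerset.filter (fun F => (↑F : Set (Sym2 V)) ⊆ ω ∧ ∀ v, Odd (F.filter (fun e => v ∈ e)).card ↔ v ∈ Finset.univ.image a); let u : Set (Sym2 V) → ℝ := fun ω => (((sol ω).filter (fun F => ∀ i j, (SimpleGraph.fromEdgeSet (↑F : Set (Sym2 V))).Reachable (a i) (a j))).card : ℝ) / ((sol ω).card : ℝ); c * φ.real {ω | ∀ i j, (Literature.Probability.Percolation.openGraph ω).Reachable (a i) (a j)} ≤ ∫ ω, u ω ∂φ)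 := by
  intro h
  set a : Fin 4 → Unit := fun _ => () with ha_def
  have ha0 : ∀ i, a i = a 0 := fun _ => rfl
  have hyp : (1 : ℝ) * zMass (⊥ : SimpleGraph Unit) (Real.tanh 0) a (fun _ => True) ≤
      zMass (⊥ : SimpleGraph Unit) (Real.tanh 0) a (fun F => JoinsAll a F) := by
    rw [zMass_eq_zero_of_const _ _ a ha0, zMass_eq_zero_of_const _ _ a ha0, mul_zero]
  have key := h Unit ⊥ 0 le_rfl a 1 hyp
  have hsol := sol_eq_empty_of_const (⊥ : SimpleGraph Unit) a ha0
  have hset : {ω : Set (Sym2 Unit) |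
      ∀ i j : Fin 4, (Literature.Probability.Percolation.openGraph ω).Reachable (a i) (a j)} = Set.univ :=
    Set.eq_univ_of_forall fun ω i j => SimpleGraph.Reachable.refl _
  haveI : IsProbabilityMeasure (rcMeasure (⊥ : SimpleGraph Unit) (fkIsingParam 0) 2 ∅) :=
    isProbabilityMeasure_rcMeasure _ (fkIsingParam_mem_Icc le_rfl) (by norm_num) _
  simp only [hsol, hset, probReal_univ, Finset.card_empty, Nat.cast_zero, div_zero,
    integral_zero, mul_one] at key
  exact absurd key (by norm_num)

end Summit.CriticalPhenomena.Ising3DConformalLimit.ParityRobustMergingNegative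

end
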